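import Summits.Ventures.QEC.Thresholds.ToricCodePhenomenologicalThresholds
import Literature.InformationTheory.QuantumCodes.HypergraphProductThresholds
import Literature.InformationTheory.QuantumCodes.CSSPhenomenologicalRadius
import HarnessLib

/-!
# Certified thresholds of the PLANAR surface codes (hypergraph product of the repetition code with its
# transpose): code capacity `p₀(3) ≈ .0286`, erasure `1/3`, phenomenological `p₀(5) ≈ .0101`

Venture QEC, `Summits/Ventures/QEC/Thresholds/` (LADDER-QEC rung Q5, "families beyond the toric code";
qec-lit-2 gen 3). Packaging of `HypergraphProductThresholds.lean` (Literature: the planar surface code family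
`planarHX k = H_X(HGP(H, Hᵀ))`, `H` the `(k+1) × (k+2)` repetition parity-check matrix — `(k+2)² + (k+1)²`
qubits, one logical qubit (`planarXString_logical`), `X`-checks of weight `≤ 4`, distance of the
`H_X`-detected sector `≥ k+2` by the tree's Tillich–Zémor Theorem 9) in the cell's vocabulary
`IsThresholdLowerBound` / `thresholdValue` / `accuracyThreshold`. HONEST FRAMING: every statement is
UNCONDITIONAL, kernel axioms, no named fact, no `native_decide`; one error type (the sector detected by
`H_X`, trivial errors `rowsp H_Z`); decoders = EVERY family of minimum-weight (space-time) decoders, the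
canonical ones included (`planar_isMinWeight_minWeight`, non-vacuity of the decoder class). The numbers are the
Dumer–Kovalev–Pryadko cluster-expansion constants for check weight `4` — the same as the toric rows
(`css_isThresholdLowerBound_weightFour`, `phenomThreshold_elementary_unconditional`); what is new is the
FAMILY: an explicit non-toric CSS family (open boundaries), obtained through the generic hypergraph-product
pipeline rather than the torus cycle geometry.

| noise model | certified lower bound | theorem |
|---|---|---|
| code capacity (independent flips of this sector) | `p₀(3) = (3-2√2)/6 > .0285` | `planar_isThresholdLowerBound` |
| erasure / loss (known locations) | `1/3` | `planar_erasure_isThresholdLowerBound` |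
| phenomenological, `q = p`, `T(k)` polynomial | `p₀(5) = (5-2√6)/10 > .0101` | `planar_phenom_isThresholdLowerBound` |
| the same three for the other sector (`H_Z`-detected) | `p₀(3)`, `1/3`, `p₀(5)` | `…'` versions; `planar_bothSectors_belowThreshold` |

## References

* [TillichZemor2014] J.-P. Tillich, G. Zémor, IEEE Trans. IT 60 (2014) 1193, §3 and Thm 9.
* [DumerKovalevPryadko2015] I. Dumer, A. A. Kovalev, L. P. Pryadko, PRL 115 (2015) 050502, Thms 2–3, p. 5.
* [DennisEtAl2002] E. Dennis, A. Kitaev, A. Landahl, J. Preskill, J. Math. Phys. 43 (2002) 4452, §5.3.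
-/

noncomputable section

namespace Summit.Ventures.QEC.Thresholds

open Filter Topology Finset Matrix
open Literature.InformationTheory.QuantumCodes

/-! ### Code capacity -/

open Classical in
/-- Failure probabilities of a decoder family `D` for the planar surface codes under independent errors of
rate `p` on this sector. [cite: DumerKovalevPryadko2015, eq. (succesful-decoding) (failure = residual not trivial)] -/
def planarFailureFamily (D : ∀ k, Decoder (PlanarCheck k → ZMod 2) (PlanarQubit k → ZMod 2)) : ℕ → ℝ → ℝ :=
  fun k p => ∑ e ∈ univ.filter (fun e : PlanarQubit k → ZMod 2 =>
    ¬ (D k).Corrects (fun e => planarHX k *ᵥ e) (planarSZ k : Set (PlanarQubit k → ZMod 2)) e),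
    bernoulliWeight p (supp e)

/-- `p < p₀(ν)` with `ν ≥ 1` gives the cluster-expansion smallness `4ν² p(1-p) < 1`.
[cite: DennisEtAl2002, §5.3 eq. (threshold_2d)] -/
theorem four_mul_sq_mul_lt_one_of_lt_thresholdValue {ν p : ℝ} (hν : 1 ≤ ν)
    (hpp : p < thresholdValue ν) : 4 * ν ^ 2 * (p * (1 - p)) < 1 := by
  have hsum : p + thresholdValue ν < 1 := by
    have := thresholdValue_le_half ν
    have := thresholdValue_nonneg ν
    linarith
  have hlt := mul_one_sub_lt_mul_one_sub hpp hsum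
  have hν2 : 0 < 4 * ν ^ 2 := by positivity
  have h := four_mul_sq_mul_thresholdValue hν
  calc 4 * ν ^ 2 * (p * (1 - p)) < 4 * ν ^ 2 * (thresholdValue ν * (1 - thresholdValue ν)) :=
        mul_lt_mul_of_pos_left hlt hν2
    _ = 1 := h

/-- **Code-capacity threshold of the planar surface codes `≥ p₀(3) = (3-2√2)/6 ≈ .0286`**, for EVERY
family of minimum-weight decoders of this sector. UNCONDITIONAL.
[cite: DumerKovalevPryadko2015, Thm 2 (y = 0, w = 4)] -/
theorem planar_isThresholdLowerBound (D : ∀ k, Decoder (PlanarCheck k → ZMod 2) (PlanarQubit k → ZMod 2))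
    (hD : ∀ k, (D k).IsMinWeight (fun e => planarHX k *ᵥ e) {x | planarHX k *ᵥ x = 0} hammingNorm) :
    IsThresholdLowerBound (planarFailureFamily D) (thresholdValue 3) := by
  intro p hp₀ hpp
  have hp : p ≤ 1 / 2 := le_trans hpp.le (thresholdValue_le_half 3)
  have h4 := four_mul_sq_mul_lt_one_of_lt_thresholdValue (by norm_num) hpp
  have h36 : 36 * (p * (1 - p)) < 1 := by linarith
  exact planar_codeCapacityThreshold D hD hp₀ hp h36

/-- Non-vacuity of the decoder class: the canonical minimum-weight decoder of the planar sector qualifies.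
[cite: DumerKovalevPryadko2015, p. 3 (exhaustive search decoder)] -/
theorem planar_isMinWeight_minWeight (k : ℕ) :
    (Decoder.minWeight (fun e : PlanarQubit k → ZMod 2 => planarHX k *ᵥ e) hammingNorm).IsMinWeight
      (fun e => planarHX k *ᵥ e) {x | planarHX k *ᵥ x = 0} hammingNorm := by
  refine Decoder.isMinWeight_minWeight _ _ _ (fun y z h => ?_) (fun x => ?_)
  · show planarHX k *ᵥ (y - z) = 0
    rw [Matrix.mulVec_sub]
    have h' : planarHX k *ᵥ y = planarHX k *ᵥ z := h
    rw [h', sub_self]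
  · rw [show -x = x from funext fun i => ZMod.neg_eq_self_mod_two (x i)]

/-- The canonical instance: minimum-weight decoding of the planar surface codes has threshold `≥ p₀(3)`.
[cite: DumerKovalevPryadko2015, Thm 2 (y = 0, w = 4)] -/
theorem planar_isThresholdLowerBound_minWeight :
    IsThresholdLowerBound
      (planarFailureFamily fun k => Decoder.minWeight (fun e : PlanarQubit k → ZMod 2 => planarHX k *ᵥ e) hammingNorm)
      (thresholdValue 3) :=
  planar_isThresholdLowerBound _ planar_isMinWeight_minWeight

/-- **`p_c > .0285`** for the planar surface codes under minimum-weight decoding (decimal, kernel).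
[cite: DumerKovalevPryadko2015, p. 5 (p_Zc* ≈ 0.029 for weight-4 codes)] -/
theorem planar_accuracyThreshold_gt (D : ∀ k, Decoder (PlanarCheck k → ZMod 2) (PlanarQubit k → ZMod 2))
    (hD : ∀ k, (D k).IsMinWeight (fun e => planarHX k *ᵥ e) {x | planarHX k *ᵥ x = 0} hammingNorm) :
    (0.0285 : ℝ) < accuracyThreshold (planarFailureFamily D) :=
  lt_of_lt_of_le thresholdValue_three_bounds.1
    (le_accuracyThreshold (planar_isThresholdLowerBound D hD) ((thresholdValue_le_half 3).trans (by norm_num)))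

/-! ### Erasures -/

/-- The probability that an independent loss pattern of rate `y` is uncorrectable for this sector of the
`k`-th planar surface code. [cite: DumerKovalevPryadko2015, Thm 2 (erasure part)] -/
def planarErasureFamily : ℕ → ℝ → ℝ :=
  fun k y => ErasureDecoder.uncorrectableProb {x : PlanarQubit k → ZMod 2 | planarHX k *ᵥ x = 0}
    (planarSZ k : Set (PlanarQubit k → ZMod 2)) y

/-- **Erasure threshold of the planar surface codes `≥ 1/3`.** UNCONDITIONAL.
[cite: DumerKovalevPryadko2015, Thm 2 (erasure part, w = 4)] -/
theorem planar_erasure_isThresholdLowerBound : IsThresholdLowerBound planarErasureFamily (1 / 3) :=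
  fun _ hy₀ hy => planar_erasureThreshold hy₀ hy

/-- `1/3 ≤ y_c` for the planar surface codes. [cite: DumerKovalevPryadko2015, p. 5 (y_c* = 1/3)] -/
theorem planar_erasure_accuracyThreshold_ge : (1 / 3 : ℝ) ≤ accuracyThreshold planarErasureFamily :=
  le_accuracyThreshold planar_erasure_isThresholdLowerBound (by norm_num)

/-! ### Phenomenological noise (`q = p`) -/

/-- Failure probabilities of the `T(k)`-round memory experiments of the planar surface codes with noisy
syndrome measurement, `q = p`. [cite: DennisEtAl2002, §5.2 (Prob_fail), §5.3 (p = q)] -/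
def planarPhenomFailureFamily (T : ℕ → ℕ)
    (D : ∀ k, CSSPhenom.STDecoder (PlanarCheck k) (PlanarQubit k) (T k)) : ℕ → ℝ → ℝ :=
  fun k p => CSSPhenom.phenomFailureProb (planarHX k) (T k) (planarSZ k : Set (PlanarQubit k → ZMod 2)) (D k) p p

/-- **Phenomenological threshold of the planar surface codes `≥ p₀(5) = (5-2√6)/10 ≈ .0101`** for every
polynomially bounded schedule of rounds and EVERY family of minimum-weight space-time decoders.
UNCONDITIONAL. [cite: DumerKovalevPryadko2015, Thm 3 with p. 5 (w → w + 2)] -/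
theorem planar_phenom_isThresholdLowerBound {T : ℕ → ℕ} (hT : ToricCode.IsPolyBounded T)
    {D : ∀ k, CSSPhenom.STDecoder (PlanarCheck k) (PlanarQubit k) (T k)}
    (hD : ∀ k, (D k).IsMinWeight (CSSPhenom.stSyn (planarHX k) (T k))
      (CSSPhenom.stCycles (planarHX k) (T k)) hammingNorm) :
    IsThresholdLowerBound (planarPhenomFailureFamily T D) (thresholdValue 5) := by
  intro p hp₀ hpp
  have hp : p ≤ 1 / 2 := le_trans hpp.le (thresholdValue_le_half 5)
  have h4 := four_mul_sq_mul_lt_one_of_lt_thresholdValue (by norm_num) hpp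
  have h100 : 100 * (p * (1 - p)) < 1 := by linarith
  exact planar_phenomThreshold T hT D hD hp₀ hp h100

/-- The canonical instance (`T = k + 1` rounds, minimum-weight space-time decoding).
[cite: DumerKovalevPryadko2015, Thm 3 with p. 5 (w → w + 2)] -/
theorem planar_phenom_isThresholdLowerBound_minWeight :
    IsThresholdLowerBound
      (planarPhenomFailureFamily (fun k => k + 1)
        fun k => Decoder.minWeight (CSSPhenom.stSyn (planarHX k) (k + 1)) hammingNorm)
      (thresholdValue 5) :=
  planar_phenom_isThresholdLowerBound isPolyBounded_succ fun k => CSSPhenom.isMinWeight_minWeight (planarHX k) (k + 1)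

/-- **`p_c > .0101`** under phenomenological noise for the planar surface codes (decimal, kernel).
[cite: DennisEtAl2002, §5.3 eq. (threshold_iso_num)] -/
theorem planar_phenom_accuracyThreshold_gt {T : ℕ → ℕ} (hT : ToricCode.IsPolyBounded T)
    {D : ∀ k, CSSPhenom.STDecoder (PlanarCheck k) (PlanarQubit k) (T k)}
    (hD : ∀ k, (D k).IsMinWeight (CSSPhenom.stSyn (planarHX k) (T k))
      (CSSPhenom.stCycles (planarHX k) (T k)) hammingNorm) :
    (0.0101 : ℝ) < accuracyThreshold (planarPhenomFailureFamily T D) :=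
  lt_of_lt_of_le thresholdValue_five_bounds.1
    (le_accuracyThreshold (planar_phenom_isThresholdLowerBound hT hD)
      ((thresholdValue_le_half 5).trans (by norm_num)))

/-! ### The second sector (errors detected by `H_Z`): the same three certified thresholds -/

open Classical in
/-- Failure probabilities of a decoder family for the `H_Z`-detected sector of the planar surface codes.
[cite: DumerKovalevPryadko2015, eq. (succesful-decoding)] -/
def planarFailureFamily' (D : ∀ k, Decoder (PlanarZCheck k → ZMod 2) (PlanarQubit k → ZMod 2)) :
    ℕ → ℝ → ℝ :=
  fun k p => ∑ e ∈ univ.filter (fun e : PlanarQubit k → ZMod 2 =>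
    ¬ (D k).Corrects (fun e => planarHZ k *ᵥ e) (planarSX k : Set (PlanarQubit k → ZMod 2)) e),
    bernoulliWeight p (supp e)

/-- **Second sector, code-capacity threshold `≥ p₀(3)`** for EVERY minimum-weight decoder family.
UNCONDITIONAL. [cite: DumerKovalevPryadko2015, Thm 2 (y = 0, w = 4)] -/
theorem planar_isThresholdLowerBound' (D : ∀ k, Decoder (PlanarZCheck k → ZMod 2) (PlanarQubit k → ZMod 2))
    (hD : ∀ k, (D k).IsMinWeight (fun e => planarHZ k *ᵥ e) {x | planarHZ k *ᵥ x = 0} hammingNorm) :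
    IsThresholdLowerBound (planarFailureFamily' D) (thresholdValue 3) := by
  intro p hp₀ hpp
  have hp : p ≤ 1 / 2 := le_trans hpp.le (thresholdValue_le_half 3)
  have h4 := four_mul_sq_mul_lt_one_of_lt_thresholdValue (by norm_num) hpp
  have h36 : 36 * (p * (1 - p)) < 1 := by linarith
  exact planar_codeCapacityThreshold' D hD hp₀ hp h36

/-- The probability that an independent loss pattern is uncorrectable for the second sector.
[cite: DumerKovalevPryadko2015, Thm 2 (erasure part)] -/
def planarErasureFamily' : ℕ → ℝ → ℝ :=
  fun k y => ErasureDecoder.uncorrectableProb {x : PlanarQubit k → ZMod 2 | planarHZ k *ᵥ x = 0}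
    (planarSX k : Set (PlanarQubit k → ZMod 2)) y

/-- **Second sector, erasure threshold `≥ 1/3`.** UNCONDITIONAL. [cite: DumerKovalevPryadko2015, Thm 2 (erasure part, w = 4)] -/
theorem planar_erasure_isThresholdLowerBound' : IsThresholdLowerBound planarErasureFamily' (1 / 3) :=
  fun _ hy₀ hy => planar_erasureThreshold' hy₀ hy

/-- Failure probabilities of the `T(k)`-round memory experiments, second sector (`q = p`).
[cite: DennisEtAl2002, §5.2 (Prob_fail), §5.3 (p = q)] -/
def planarPhenomFailureFamily' (T : ℕ → ℕ)
    (D : ∀ k, CSSPhenom.STDecoder (PlanarZCheck k) (PlanarQubit k) (T k)) : ℕ → ℝ → ℝ :=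
  fun k p => CSSPhenom.phenomFailureProb (planarHZ k) (T k) (planarSX k : Set (PlanarQubit k → ZMod 2)) (D k) p p

/-- **Second sector, phenomenological threshold `≥ p₀(5)`** for every polynomially bounded schedule and
EVERY minimum-weight space-time decoder family. UNCONDITIONAL.
[cite: DumerKovalevPryadko2015, Thm 3 with p. 5 (w → w + 2)] -/
theorem planar_phenom_isThresholdLowerBound' {T : ℕ → ℕ} (hT : ToricCode.IsPolyBounded T)
    {D : ∀ k, CSSPhenom.STDecoder (PlanarZCheck k) (PlanarQubit k) (T k)}
    (hD : ∀ k, (D k).IsMinWeight (CSSPhenom.stSyn (planarHZ k) (T k))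
      (CSSPhenom.stCycles (planarHZ k) (T k)) hammingNorm) :
    IsThresholdLowerBound (planarPhenomFailureFamily' T D) (thresholdValue 5) := by
  intro p hp₀ hpp
  have hp : p ≤ 1 / 2 := le_trans hpp.le (thresholdValue_le_half 5)
  have h4 := four_mul_sq_mul_lt_one_of_lt_thresholdValue (by norm_num) hpp
  have h100 : 100 * (p * (1 - p)) < 1 := by linarith
  exact planar_phenomThreshold' T hT D hD hp₀ hp h100

/-- **Both sectors at once**: below `p₀(3)` every pair of minimum-weight decoder families (one per sector) of
the planar surface codes has BOTH logical failure probabilities `→ 0` (code capacity). UNCONDITIONAL.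
[cite: DumerKovalevPryadko2015, Thm 2 (y = 0, w = 4; both error types)] -/
theorem planar_bothSectors_belowThreshold
    (DZ : ∀ k, Decoder (PlanarCheck k → ZMod 2) (PlanarQubit k → ZMod 2))
    (hDZ : ∀ k, (DZ k).IsMinWeight (fun e => planarHX k *ᵥ e) {x | planarHX k *ᵥ x = 0} hammingNorm)
    (DX : ∀ k, Decoder (PlanarZCheck k → ZMod 2) (PlanarQubit k → ZMod 2))
    (hDX : ∀ k, (DX k).IsMinWeight (fun e => planarHZ k *ᵥ e) {x | planarHZ k *ᵥ x = 0} hammingNorm)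
    {p : ℝ} (hp₀ : 0 ≤ p) (hpp : p < thresholdValue 3) :
    BelowThreshold (planarFailureFamily DZ) p ∧ BelowThreshold (planarFailureFamily' DX) p :=
  ⟨planar_isThresholdLowerBound DZ hDZ p hp₀ hpp, planar_isThresholdLowerBound' DX hDX p hp₀ hpp⟩

end Summit.Ventures.QEC.Thresholds
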